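import Summits.Ventures.PercRepro.MSTightUniqueNonFace

/-!
# The anatomy of a witness-free instance: (S1)–(S3) of Addendum 38

Dossier proofs/MINE1-theoremS.md, Addendum 38 §3, and proofs/MINE1-RSTARM-PROOF.md §3. In an
instance of (R*-M) (Addendum 37 §1) without a witness (`T ∩ L' = ∅`):

* **(S1)** `mem_of_mem_of_ne_of_noWitness`: every member of `U` strictly inside `u` is a member of
  `T` — a `y ∈ U` inside `u` contains a minimal member `z ∈ T` ((F7), `hmin`), so `y ∉ L'` (else
  `z ∈ L'`, a witness); `u \ y ∈ L'` as `y ∈ U`; the unique-non-face lemma (U1)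
  (`eq_of_sdiff_mem_of_notMem`) makes `y` a face, and `T = U ∩ ↓T` ((F2), `hF2`) a member.
* **(S3)** `erase_notMem_of_valid`: for a valid set `v` (`v ∈ L'`, `v ⊆ u`, `v ∉ C`) and
  `a ∈ u \ v`, `u.erase a ∉ U` — else it would be a member containing `v`. So every valid set
  contains `W = {a ∈ u : u.erase a ∈ U}`.
* **(S2)** `exists_erase_notMem`: some `a ∈ u` has `u.erase a ∉ U` (`I ≠ ∅`), from (AO).

The hypotheses are the instance's data: `L'` a down-set containing `∅` but not `u`, `U` the
complements of `L'` (only `univ \ y ∈ L'` for `y ∈ U` is used), `T ⊆ U` with `C = ↓T`,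
(F2) `U ∩ ↓T ⊆ T`, (F7) every member of `U` inside `u` contains a member of `T`, no witness,
(Sig), and the (F2) count of the `u`-restriction in the form of MSTightUniqueNonFace.lean.
-/

namespace PercRepro.MSTight

open Finset

variable {α : Type*} [DecidableEq α] [Fintype α]

/-- **(S1).** In a witness-free instance every member of `U` strictly inside `u` is a member of
`T`. -/
theorem mem_of_mem_of_ne_of_noWitness {L' U T C : Finset (Finset α)} {u : Finset α}
    (hL : ∀ w ∈ L', ∀ w', w' ⊆ w → w' ∈ L') (hU : ∀ y ∈ U, univ \ y ∈ L')
    (hC : ∀ x ∈ C, ∃ t ∈ T, x ⊆ t) (hF2 : ∀ y ∈ U, (∃ t ∈ T, y ⊆ t) → y ∈ T)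
    (hnw : ∀ t ∈ T, t ∉ L') (hmin : ∀ y ∈ U, y ⊆ u → ∃ z ∈ T, z ⊆ y)
    (hempty : ∅ ∈ L') (hu : u ∉ L') (huC : u ∉ C)
    (hSig : ∀ x ∈ L', x ⊆ u → u \ x ∉ L' → x ∈ C)
    (hcount : ((L'.filter fun w => w ⊆ u) ∩ (C.filter fun w => w ⊆ u)).card
      = (complWithin u (L'.filter fun w => w ⊆ u) ∩ (C.filter fun w => w ⊆ u)).card + 1)
    {y : Finset α} (hyU : y ∈ U) (hyu : y ⊆ u) (hyne : y ≠ u) : y ∈ T := by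
  have hyL : y ∉ L' := by
    intro hyL
    obtain ⟨z, hzT, hzy⟩ := hmin y hyU hyu
    exact hnw z hzT (hL y hyL z hzy)
  have hcomp : u \ y ∈ L' := by
    refine hL _ (hU y hyU) _ ?_
    intro a ha
    rw [mem_sdiff] at ha ⊢
    exact ⟨mem_univ a, ha.2⟩
  have hyC : y ∈ C := by
    by_contra hyC
    apply hyne
    refine eq_of_sdiff_mem_of_notMem (A := L'.filter fun w => w ⊆ u)
      (C := C.filter fun w => w ⊆ u) ?_ ?_ ?_ ?_ ?_ hcount hyu ?_ ?_ ?_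
    · intro x hx
      exact (mem_filter.1 hx).2
    · exact mem_filter.2 ⟨hempty, empty_subset u⟩
    · intro h
      exact hu (mem_filter.1 h).1
    · intro h
      exact huC (mem_filter.1 h).1
    · intro x hx hx'
      obtain ⟨hxL, hxu⟩ := mem_filter.1 hx
      refine mem_filter.2 ⟨hSig x hxL hxu ?_, hxu⟩
      intro hux
      exact hx' (mem_filter.2 ⟨hux, sdiff_subset⟩)
    · exact mem_filter.2 ⟨hcomp, sdiff_subset⟩
    · intro h
      exact hyL (mem_filter.1 h).1
    · intro h
      exact hyC (mem_filter.1 h).1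
  exact hF2 y hyU (hC y hyC)

omit [Fintype α] in
/-- **(S3).** Given (S1) in the form `hS1`, a valid set `v` (`v ∈ L'`, `v ⊆ u`, `v ∉ C`) and
`a ∈ u \ v`: `u.erase a ∉ U`. -/
theorem erase_notMem_of_valid {U T C : Finset (Finset α)} {u : Finset α}
    (hCT : ∀ t ∈ T, ∀ x, x ⊆ t → x ∈ C)
    (hS1 : ∀ y ∈ U, y ⊆ u → y ≠ u → y ∈ T)
    {v : Finset α} (hvu : v ⊆ u) (hvC : v ∉ C) {a : α} (hau : a ∈ u) (hav : a ∉ v) :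
    u.erase a ∉ U := by
  intro hmem
  have hT : u.erase a ∈ T := by
    refine hS1 _ hmem (erase_subset a u) (fun h => ?_)
    have hna := notMem_erase a u
    rw [h] at hna
    exact hna hau
  apply hvC
  refine hCT _ hT v ?_
  intro b hb
  rw [mem_erase]
  exact ⟨fun hba => hav (hba ▸ hb), hvu hb⟩

omit [Fintype α] in
/-- **(S2).** Given (S1) and (AO), some `a ∈ u` has `u.erase a ∉ U` — the set `I` is nonempty. -/
theorem exists_erase_notMem {L' U T C : Finset (Finset α)} {u : Finset α}
    (hCT : ∀ t ∈ T, ∀ x, x ⊆ t → x ∈ C)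
    (hS1 : ∀ y ∈ U, y ⊆ u → y ≠ u → y ∈ T) (hu : u ∉ L')
    {v₀ : Finset α} (hv₀ : v₀ ∈ L') (hv₀u : v₀ ⊆ u) (hv₀C : v₀ ∉ C) :
    ∃ a ∈ u, u.erase a ∉ U := by
  have hne : v₀ ≠ u := fun h => hu (h ▸ hv₀)
  obtain ⟨a, hau, hav⟩ := exists_of_ssubset (ssubset_of_subset_of_ne hv₀u hne)
  exact ⟨a, hau, erase_notMem_of_valid hCT hS1 hv₀u hv₀C hau hav⟩

end PercRepro.MSTight
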